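import Mathlib
import Summits.KontsevichZagierPeriods.KontsevichZagierPeriods.Theorems.SoloInformedShearDiv
import HarnessLib
import HarnessLib.Audit

/-!
# SoloInformed — divergence across an adjacent band, lower side (PRES-RAT(2), Phase IV-3b)

Solo programme `solo-KontsevichZagierPeriods-informed`, session s110.  The mirror image of the
SHEAR DIVERGENCE lemma (`soloInformed_not_integrableOn_shear`): for `a` differentiable on
`(u, v)` and `η > 0`, the function `(x, y) ↦ (a(x) − y)⁻¹` is not integrable on the band
`{u < x < v, a(x) − η < y < a(x)}` adjacent to the graph of `a` FROM BELOW, and the comparison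
form (`c ≤ |f (x, y)| · (a(x) − y)` on the band forbids integrability of `f` on any `Ω` containing
it).  Proof: the straightening between `a − η` and `a` pulls the integrand back to
`(x, t) ↦ (1 − t)⁻¹` on the rectangle `(u, v) × (0, 1)`; the reflection `t ↦ 1 − t` of `ℝ` is
measure preserving, so this reduces to the non-integrability of `t⁻¹` on `(0, 1)`, and Fubini
along `MeasurableEquiv.finTwoArrow` as before.

References: folklore; PRES-RAT(2) design memo §0 (NONINT).
-/

noncomputable section

open scoped BigOperators Topology ENNReal
open MeasureTheory Measure Set Filter Metric

namespace Summit.KontsevichZagierPeriods.KontsevichZagierPeriods.Theorems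

/-! ### `(x, t) ↦ 1/(1 − t)` is not integrable on a rectangle -/

/-- **Fubini step, reflected.** `(x, t) ↦ (1 − t)⁻¹` is not integrable on the rectangle
`(u, v) × (0, 1)` (`u < v`). -/
theorem soloInformed_not_integrableOn_inv_one_sub_snd {u v : ℝ} (huv : u < v) :
    ¬ IntegrableOn (fun x : Fin 2 → ℝ => (1 - x 1)⁻¹) (soloInformedRect u v) := by
  intro h
  set e : (Fin 2 → ℝ) ≃ᵐ ℝ × ℝ := MeasurableEquiv.finTwoArrow with he_def
  have he : MeasurePreserving e volume volume := volume_preserving_finTwoArrow ℝ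
  have hpre : e ⁻¹' (Ioo u v ×ˢ Ioo (0 : ℝ) 1) = soloInformedRect u v := by
    ext x
    simp [he_def, soloInformedRect, Set.mem_prod, mem_Ioo]
  have hcomp : ((fun p : ℝ × ℝ => (1 - p.2)⁻¹) ∘ e) = fun x : Fin 2 → ℝ => (1 - x 1)⁻¹ := by
    funext x
    simp [he_def]
  have h2 : IntegrableOn (fun p : ℝ × ℝ => (1 - p.2)⁻¹) (Ioo u v ×ˢ Ioo (0 : ℝ) 1) volume := by
    rw [← he.integrableOn_comp_preimage e.measurableEmbedding, hcomp, hpre]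
    exact h
  rw [IntegrableOn, Measure.volume_eq_prod, ← Measure.prod_restrict] at h2
  have hae := h2.prod_right_ae
  -- one variable: `t ↦ (1 − t)⁻¹` is not integrable on `(0, 1)` (reflection `t ↦ 1 − t` of the
  -- divergence of `t⁻¹` at `0`); kept local (the tree has equivalent one-variable statements).
  have h1d : ¬ IntegrableOn (fun t : ℝ => (1 - t)⁻¹) (Ioo (0 : ℝ) 1) := by
    intro h
    have he1 : MeasurePreserving (fun t : ℝ => 1 - t) volume volume :=
      measurePreserving_sub_left volume (1 : ℝ)
    have hemb : MeasurableEmbedding (fun t : ℝ => 1 - t) := measurableEmbedding_subLeft (1 : ℝ)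
    have hpre1 : (fun t : ℝ => 1 - t) ⁻¹' Ioo (0 : ℝ) 1 = Ioo 0 1 := by
      ext t
      simp only [mem_preimage, mem_Ioo]
      constructor
      · rintro ⟨h1, h2⟩; exact ⟨by linarith, by linarith⟩
      · rintro ⟨h1, h2⟩; exact ⟨by linarith, by linarith⟩
    have hcomp1 : ((fun t : ℝ => t⁻¹) ∘ fun t : ℝ => 1 - t) = fun t : ℝ => (1 - t)⁻¹ := rfl
    have h3 : IntegrableOn (fun t : ℝ => t⁻¹) (Ioo (0 : ℝ) 1) := by
      rw [← he1.integrableOn_comp_preimage hemb, hcomp1, hpre1]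
      exact h
    have h3' : IntegrableOn (fun t : ℝ => t ^ (-1 : ℝ)) (Ioo (0 : ℝ) 1) := by
      refine h3.congr_fun (fun t _ => ?_) measurableSet_Ioo
      exact (Real.rpow_neg_one t).symm
    have := (intervalIntegral.integrableOn_Ioo_rpow_iff (s := -1) one_pos).1 h3'
    norm_num at this
  have hfalse : ∀ᵐ x ∂(volume.restrict (Ioo u v) : Measure ℝ), False := by
    filter_upwards [hae] with x hx
    exact h1d hx
  rw [eventually_false_iff_eq_bot, ae_eq_bot, Measure.restrict_eq_zero, Real.volume_Ioo] at hfalse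
  have hpos : (0 : ℝ≥0∞) < ENNReal.ofReal (v - u) := by
    rw [ENNReal.ofReal_pos]
    linarith
  exact hpos.ne' hfalse

/-! ### The band below the graph -/

/-- The band of height `η` adjacent from BELOW to the graph of `a` over `(u, v)`:
`{(x, y) | u < x < v, a(x) − η < y < a(x)}`. [this work] -/
def soloInformedAdjBandBelow (a : ℝ → ℝ) (u v η : ℝ) : Set (Fin 2 → ℝ) :=
  {y | (u < y 0 ∧ y 0 < v) ∧ a (y 0) - η < y 1 ∧ y 1 < a (y 0)}

/-- The lower band is the image of the rectangle under the straightening between `a − η` and `a`. -/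
theorem soloInformed_shear_image_below {a : ℝ → ℝ} {u v η : ℝ} (hη : 0 < η) :
    soloInformedBandMap (fun s => a s - η) a '' soloInformedRect u v =
      soloInformedAdjBandBelow a u v η := by
  rw [soloInformed_bandMap_image_rect (fun s _ _ => by linarith)]
  rfl

/-- The lower band is open when `a` is continuous on `(u, v)`. -/
theorem soloInformed_isOpen_adjBandBelow {a : ℝ → ℝ} {u v η : ℝ} (ha : ContinuousOn a (Ioo u v)) :
    IsOpen (soloInformedAdjBandBelow a u v η) := by
  have hU : IsOpen {y : Fin 2 → ℝ | u < y 0 ∧ y 0 < v} :=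
    isOpen_Ioo.preimage (continuous_apply 0)
  have hc : ContinuousOn (fun y : Fin 2 → ℝ => a (y 0) - y 1) {y : Fin 2 → ℝ | u < y 0 ∧ y 0 < v} := by
    refine ContinuousOn.sub ?_ (continuous_apply 1).continuousOn
    exact ha.comp (continuous_apply 0).continuousOn fun y hy => hy
  have h := hc.isOpen_inter_preimage hU (isOpen_Ioo (a := 0) (b := η))
  convert h using 1
  ext y
  simp only [soloInformedAdjBandBelow, mem_setOf_eq, mem_inter_iff, mem_preimage, mem_Ioo]
  constructor
  · rintro ⟨h0, h1, h2⟩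
    exact ⟨h0, by linarith, by linarith⟩
  · rintro ⟨h0, h1, h2⟩
    exact ⟨h0, by linarith, by linarith⟩

/-- **SHEAR DIVERGENCE, lower side.**  For `a` differentiable on `(u, v)` (`u < v`) and `η > 0`,
`(x, y) ↦ (a(x) − y)⁻¹` is not integrable on the band `{u < x < v, a(x) − η < y < a(x)}`. -/
theorem soloInformed_not_integrableOn_shear_below {a a' : ℝ → ℝ} {u v η : ℝ} (huv : u < v)
    (hη : 0 < η) (ha : ∀ s : ℝ, u < s → s < v → HasDerivAt a (a' s) s) :
    ¬ IntegrableOn (fun y : Fin 2 → ℝ => (a (y 0) - y 1)⁻¹) (soloInformedAdjBandBelow a u v η) := by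
  intro h
  set b : ℝ → ℝ := fun s => a s - η with hb_def
  have hlt : ∀ x ∈ soloInformedRect u v, b (x 0) < a (x 0) := fun x _ => by
    simp only [hb_def]
    linarith
  have hderiv : ∀ x ∈ soloInformedRect u v,
      HasFDerivWithinAt (soloInformedBandMap b a) (soloInformedBandDeriv b a a' a' x)
        (soloInformedRect u v) x := fun x hx =>
    (soloInformed_hasFDerivAt_bandMap ((ha _ hx.1.1 hx.1.2).sub_const η)
      (ha _ hx.1.1 hx.1.2)).hasFDerivWithinAt
  have hinj : InjOn (soloInformedBandMap b a) (soloInformedRect u v) :=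
    soloInformed_injOn_bandMap hlt
  have hmeas : MeasurableSet (soloInformedRect u v) := (soloInformed_isOpen_rect u v).measurableSet
  rw [← soloInformed_shear_image_below hη,
    integrableOn_image_iff_integrableOn_abs_det_fderiv_smul volume hmeas hderiv hinj] at h
  have h' : IntegrableOn (fun x : Fin 2 → ℝ => (1 - x 1)⁻¹) (soloInformedRect u v) := by
    refine h.congr_fun (fun x hx => ?_) hmeas
    have hx1 : 1 - x 1 ≠ 0 := by linarith [hx.2.2]
    have hba : a (x 0) - b (x 0) = η := by simp [hb_def]
    dsimp only
    rw [soloInformed_det_bandDeriv, hba, abs_of_pos hη, smul_eq_mul,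
      soloInformedBandMap_apply_zero, soloInformedBandMap_apply_one, hba]
    simp only [hb_def]
    have hne : η * (1 - x 1) ≠ 0 := mul_ne_zero hη.ne' hx1
    field_simp
    rw [show a (x 0) - (a (x 0) - η + η * x 1) = η * (1 - x 1) by ring, div_self hne]
  exact soloInformed_not_integrableOn_inv_one_sub_snd huv h'

/-- **Comparison form, lower side.**  If `c > 0`, `c ≤ |f (x, y)| · (a(x) − y)` on the lower
band and the band lies in `Ω`, then `f` is not integrable on `Ω`. -/
theorem soloInformed_not_integrableOn_of_shear_bound_below {a a' : ℝ → ℝ} {u v η c : ℝ}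
    {f : (Fin 2 → ℝ) → ℝ} {Ω : Set (Fin 2 → ℝ)} (huv : u < v) (hη : 0 < η) (hc : 0 < c)
    (ha : ∀ s : ℝ, u < s → s < v → HasDerivAt a (a' s) s)
    (hΩ : soloInformedAdjBandBelow a u v η ⊆ Ω)
    (hbound : ∀ y ∈ soloInformedAdjBandBelow a u v η, c ≤ |f y| * (a (y 0) - y 1))
    (hf : IntegrableOn f Ω) : False := by
  have hcont : ContinuousOn a (Ioo u v) := fun s hs =>
    (ha s hs.1 hs.2).continuousAt.continuousWithinAt
  have hopen := soloInformed_isOpen_adjBandBelow (η := η) hcont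
  have hfB : IntegrableOn f (soloInformedAdjBandBelow a u v η) := hf.mono_set hΩ
  have hg : ContinuousOn (fun y : Fin 2 → ℝ => (a (y 0) - y 1)⁻¹)
      (soloInformedAdjBandBelow a u v η) := by
    refine ContinuousOn.inv₀ ?_ fun y hy => by linarith [hy.2.2]
    refine ContinuousOn.sub ?_ (continuous_apply 1).continuousOn
    exact hcont.comp (continuous_apply 0).continuousOn fun y hy => hy.1
  refine soloInformed_not_integrableOn_shear_below huv hη ha ?_
  refine Integrable.mono (hfB.smul (c⁻¹)) (hg.aestronglyMeasurable hopen.measurableSet) ?_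
  refine (ae_restrict_iff' hopen.measurableSet).2 (Eventually.of_forall fun y hy => ?_)
  have hd : 0 < a (y 0) - y 1 := by linarith [hy.2.2]
  have hb := hbound y hy
  rw [Real.norm_eq_abs, abs_of_pos (inv_pos.2 hd), Pi.smul_apply, smul_eq_mul, norm_mul,
    Real.norm_eq_abs, Real.norm_eq_abs, abs_of_pos (inv_pos.2 hc)]
  rw [inv_le_iff_one_le_mul₀ hd]
  have : 1 ≤ c⁻¹ * (|f y| * (a (y 0) - y 1)) := by
    rw [le_inv_mul_iff₀ hc]
    simpa using hb
  calc (1 : ℝ) ≤ c⁻¹ * (|f y| * (a (y 0) - y 1)) := this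
    _ = c⁻¹ * |f y| * (a (y 0) - y 1) := by ring

end Summit.KontsevichZagierPeriods.KontsevichZagierPeriods.Theorems

end
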